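import Literature.AlgebraicGeometry.Resolution.KnafKuhlmann2009Prop310
import Literature.AlgebraicGeometry.Resolution.SmoothUniformizationProofs
import Literature.AlgebraicGeometry.Resolution.NormalizationFractions
import HarnessLib

/-!
# Relative local uniformization over a regular model of a subfield
# (stmt-ResolutionOfSingularities-0641, line `pfaff-line-log-final-forms`,
# stub `stub_relLU_of_regularBase`)

Knaf–Kuhlmann 2009 (H. Knaf, F.-V. Kuhlmann, *Every place admits local uniformization in a
finite extension of the function field*, Adv. Math. 221 (2009) 428–453 = arXiv:math/0702856),
Prop. 3.5 (second case: "The smoothness of `C'|B_{q_B}` and the regularity of `B_{q_B}` thus imply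
the regularity of `C_{q_C}`") and Cor. 3.6 (stacking models along `K ⊇ F₀ ⊇ k`), with a REGULAR
(not necessarily smooth) finitely generated `k`-model of the subfield `F₀` as the base.

Setting: `(K, O)` a valued field over `k ⊆ O`, `F₀ ⊆ K` a subfield containing the image of `k`,
`O_{F₀} := O ∩ F₀`. Hypotheses: (hB) every finite subset of `O ∩ F₀` lies in a finitely
generated `k`-subalgebra `B ⊆ O ∩ F₀` with `Frac B = F₀` whose local ring at the centre
`𝔪_O ∩ B` is regular; (hF) every finite `Z ⊆ O` is smoothly `O_{F₀}`-uniformizable on a model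
of `K` (`IsSmoothlyUniformizableIn`). Conclusion (`stub_relLU_of_regularBase`): every finitely
generated `k`-subalgebra `S ⊆ O` is dominated by a finitely generated `A ⊆ O` with `Frac A = K`
and `A_{𝔪_O ∩ A}` regular.

Proof. Let `Z₀` generate `S`. By (hF) there is an `O_{F₀}`-model `A` of `K`, smooth at the
centre, with `Z₀ ⊆ A_q`. Knaf–Kuhlmann's Prop. 3.2 in the strong form
`knafKuhlmann2009_prop32_adjoin` gives a finite `S₀ ⊆ O ∩ F₀` and generators `G` such that for
every ring `S₀ ⊆ S' ⊆ O_{F₀}` the algebra `S'[G]` is finitely presented and smooth over `S'` at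
the centre, with `Z₀` in its local ring and `Frac(S'[G]) · F₀ = K`. By (hB) choose a regular
model `B ⊇ S₀` of `F₀` and descend to `S' := B`: `C := B[G]`. Improve `C` inside `C_q` to an
everywhere smooth `B`-algebra `C₂ ⊇ Z₀` (`exists_smooth_model_over`). Then `C₂` is of finite
type over the Noetherian ring `B`, smooth over `B` at its centre `q₂`, and `q₂ ∩ B = 𝔪_O ∩ B`;
EGA IV 17.5.8 (iii) (A. Grothendieck, J. Dieudonné, *EGA IV₄*, Publ. Math. IHÉS 32 (1967),
Prop. 17.5.8, in the affine form `Grothendieck1967_17_5_8_holds`) transfers the regularity of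
`B_{𝔪_O ∩ B}` to `(C₂)_{q₂}`. Finally `C₂`, read as a `k`-subalgebra, is finitely generated
(`B` is), contains `Z₀` hence `S`, and `Frac C₂ ⊇ Frac C ⊇ B, G` so `Frac C₂ = K`.
-/

-- single-problem summit: the doubled namespace component `ResolutionOfSingularities` is forced
set_option linter.dupNamespace false

open IsLocalRing

namespace Summit.ResolutionOfSingularities.ResolutionOfSingularities.Theorems.PfaffLine

open Literature.AlgebraicGeometry.Resolution

/-- Regularity of the local ring at a prime is insensitive to replacing the prime by an equal
one (the two `Localization.AtPrime`s carry different `IsPrime` instances). [folklore] -/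
theorem isRegularLocalRing_atPrime_of_eq {R : Type*} [CommRing R] (p q : Ideal R) [p.IsPrime]
    [q.IsPrime] (h : p = q) (hp : IsRegularLocalRing (Localization.AtPrime p)) :
    IsRegularLocalRing (Localization.AtPrime q) := by
  subst h
  exact hp

/-- **Knaf–Kuhlmann 2009, Prop. 3.5 (second case) / Cor. 3.6 with a REGULAR base**: if every
finite subset of `O ∩ F₀` lies in a finitely generated `k`-model of `F₀` inside `O`, regular at
the centre, and every finite `Z ⊆ O` is smoothly `O_{F₀}`-uniformizable, then every finitely
generated `S ⊆ O` is dominated by a finitely generated `A ⊆ O` with `Frac A = K`, REGULAR at the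
centre: descend the smooth `O_{F₀}`-model to a finitely generated subring
(`knafKuhlmann2009_prop32_adjoin`), put that subring into a regular model `B` of `F₀`, and use
"smooth over regular is regular" (EGA IV 17.5.8 (iii), `Grothendieck1967_17_5_8_holds`).
[cite: KnafKuhlmann2009, Prop. 3.5 and Cor. 3.6] -/
theorem stub_relLU_of_regularBase :
    ∀ (k K : Type) [Field k] [Field K] [Algebra k K] (O : ValuationSubring K), (∀ c : k, algebraMap k K c ∈ O) → ∀ F₀ : Subfield K, (algebraMap k K).fieldRange ≤ F₀ → (∀ Z : Finset K, (∀ z ∈ Z, z ∈ O ∧ z ∈ F₀) → ∃ (B : Subalgebra k K) (hB : B.toSubring ≤ O.toSubring), (B : Set K) ⊆ F₀ ∧ (Z : Set K) ⊆ B ∧ B.FG ∧ (∀ x ∈ F₀, ∃ a ∈ B, ∃ b ∈ B, x = a / b) ∧ IsRegularLocalRing (Localization.AtPrime (Ideal.comap (Subring.inclusion hB) (IsLocalRing.maximalIdeal O)))) → (∀ Z : Finset K, (∀ z ∈ Z, z ∈ O) → Literature.AlgebraicGeometry.Resolution.IsSmoothlyUniformizableIn ↥(O.toSubring ⊓ F₀.toSubring)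 O ⊤ (Z : Set K)) → ∀ (S : Subalgebra k K), S.FG → S.toSubring ≤ O.toSubring → ∃ (A : Subalgebra k K) (h : A.toSubring ≤ O.toSubring), S ≤ A ∧ A.FG ∧ IsFractionRing A K ∧ IsRegularLocalRing (Localization.AtPrime (Ideal.comap (Subring.inclusion h) (IsLocalRing.maximalIdeal O))) := by
  intro k K _ _ _ O _hk F₀ _hkF₀ hB hF S hSfg hSO
  classical
  -- generators `Z₀` of `S`
  obtain ⟨Z₀, hZ₀⟩ := hSfg
  have hZ₀S : (Z₀ : Set K) ⊆ S := hZ₀ ▸ Algebra.subset_adjoin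
  have hZ₀O : ∀ z ∈ Z₀, z ∈ O := fun z hz => hSO (hZ₀S hz)
  -- an `O_{F₀}`-model `A` of `K`, smooth at the centre, with `Z₀ ⊆ A_q`
  let R : Type := ↥(O.toSubring ⊓ F₀.toSubring)
  obtain ⟨A, hAV, -, hfpA, hfracA, hsmA, hZA⟩ := hF Z₀ hZ₀O
  haveI := hfpA
  have hRinj : Function.Injective (algebraMap R K) := Subtype.coe_injective
  have hrangeR : Set.range (algebraMap R K) =
      ((O.toSubring ⊓ F₀.toSubring : Subring K) : Set K) := Subtype.range_coe
  -- Prop. 3.2: descent data `S₀`, `G`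
  obtain ⟨S₀, G, hS₀R, -, hdesc⟩ := knafKuhlmann2009_prop32_adjoin O R hRinj A hAV hsmA Z₀ hZA
  have hS₀ : ∀ w ∈ S₀, w ∈ O ∧ w ∈ F₀ := by
    intro w hw
    have hw' : w ∈ Set.range (algebraMap R K) := hS₀R (Finset.mem_coe.mpr hw)
    rw [hrangeR] at hw'
    exact hw'
  -- a regular model `B ⊇ S₀` of `F₀`
  obtain ⟨B, hBO, hBF₀, hS₀B, hBfg, hfracB, hregB⟩ := hB S₀ hS₀
  haveI : Algebra.FiniteType k B := (Subalgebra.fg_iff_finiteType B).mp hBfg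
  haveI : IsNoetherianRing B := Algebra.FiniteType.isNoetherianRing k B
  -- descent to `S' := B`
  have hBinj : Function.Injective (algebraMap B K) := Subtype.coe_injective
  have hrangeB : Set.range (algebraMap B K) = (B : Set K) := Subtype.range_coe
  have h2 : (S₀ : Set K) ⊆ Set.range (algebraMap B K) := by rw [hrangeB]; exact hS₀B
  have h3 : Set.range (algebraMap B K) ⊆ Set.range (algebraMap R K) := by
    rw [hrangeB, hrangeR]
    exact fun w hw => ⟨hBO hw, hBF₀ hw⟩
  obtain ⟨C, hCO, -, -, hfpC, hsmC, hZC, hclos⟩ := hdesc B hBinj h2 h3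
  haveI := hfpC
  have hBC : (B : Set K) ⊆ C := fun w hw => C.algebraMap_mem (⟨w, hw⟩ : B)
  -- `Frac C = K`
  have hclosC : Subfield.closure (C : Set K) = ⊤ := by
    have hA : Subfield.closure (A : Set K) = ⊤ :=
      subfield_closure_eq_of_frac (E := ⊤) (fun _ _ => trivial) hfracA
    rw [← hA, ← hclos]
    refine le_antisymm (Subfield.closure_mono Set.subset_union_left) (Subfield.closure_le.mpr ?_)
    refine Set.union_subset Subfield.subset_closure ?_
    rw [hrangeR]
    rintro w ⟨-, hwF₀⟩
    obtain ⟨a', ha', b', hb', rfl⟩ := hfracB w hwF₀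
    exact div_mem (Subfield.subset_closure (hBC ha')) (Subfield.subset_closure (hBC hb'))
  have hfracC : ∀ x ∈ (⊤ : Subfield K), ∃ a ∈ C, ∃ b ∈ C, x = a / b := by
    intro x _
    have hx : x ∈ Subfield.closure (C : Set K) := by rw [hclosC]; trivial
    exact exists_div_of_mem_closure C.toSubring hx
  -- improve `C` inside `C_q` to an everywhere smooth `C₂ ⊇ Z₀`
  obtain ⟨C₂, hC₂O, -, hC₂sm, hZ₀C₂, -, hfracC₂, -⟩ :=
    exists_smooth_model_over (E := (⊤ : Subfield K)) C hCO (fun _ _ => trivial) hsmC hfracC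
      Z₀ hZC
  haveI := hC₂sm
  -- EGA IV 17.5.8 (iii): `C₂` is regular at its centre since `B` is
  have hcomap : (centre C₂ O hC₂O).comap (algebraMap B C₂) = centre B O hBO := by
    ext x
    rw [Ideal.mem_comap, mem_centre_iff, mem_centre_iff]
    rfl
  have hregB' : IsRegularLocalRing (Localization.AtPrime (centre B O hBO)) := hregB
  have hregC₂ : IsRegularLocalRing (Localization.AtPrime (centre C₂ O hC₂O)) :=
    (Grothendieck1967_17_5_8_holds B C₂ inferInstance (centre C₂ O hC₂O)
      (isSmoothAt_of_formallySmooth _)).mpr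
      (isRegularLocalRing_atPrime_of_eq _ _ hcomap.symm hregB')
  -- the final `k`-subalgebra: `C₂` read over `k`
  haveI : Algebra.FiniteType B C₂ := inferInstance
  have hft : Algebra.FiniteType k C₂ := Algebra.FiniteType.trans (S := B) inferInstance this
  refine ⟨C₂.restrictScalars k, hC₂O, ?_, ?_, ?_, hregC₂⟩
  · -- `S ≤ C₂`
    rw [← hZ₀]
    exact Algebra.adjoin_le fun z hz => hZ₀C₂ hz
  · -- finitely generated over `k`
    exact (Subalgebra.fg_iff_finiteType _).mpr hft
  · -- `Frac C₂ = K`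
    exact isFractionRing_of_forall_exists_div C₂.toSubring fun z => hfracC₂ z trivial

end Summit.ResolutionOfSingularities.ResolutionOfSingularities.Theorems.PfaffLine
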